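import Mathlib.Analysis.SpecialFunctions.Pow.Real
import Mathlib.Analysis.SpecialFunctions.Sqrt
import Mathlib.Algebra.Order.BigOperators.Group.Finset
import HarnessLib

/-!
# Dimock–Yuan: the quadratic flow of a marginal coupling with a final condition (Lemma 17)

**Citation header (reproduction of PUBLISHED work; template file of the Balaban lattice Yang–Mills
cell `pub-balaban`, TEMPLATE.md §16).**
J. Dimock, C. Yuan, *Structural stability of the RG flow in the Gross–Neveu model*,
Ann. Henri Poincaré **25** (2024), doi 10.1007/s00023-024-01427-0 (= arXiv:2303.07916v3) [DimockYuan2024GNFlow],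
§4.1 "The quadratic flow" (p. 56), **Lemma 17** (TeX label `english`, arXiv source ll. 3323–3335, p. 56) with its
proof (ll. 3340–3383) and the `n = 2, m = 0` case of the remark (basicbound) (ll. 3386–3400, p. 57)
(§ numbering: arXiv v3, whose section *"The flow"* is §4 — TeX l. 3274, `\label{five}` being a NAME —,
subsections §4.1–4.5; this file's earlier versions and TEMPLATE.md ≤ v8.31 wrote «§5.x»; corrected after XREAD
C-pv02g21-1 (D3); printed pages are those of the arXiv-v3 PDF.).

**What is reproduced (everything PROVED, no named facts).**  For a sequence of one-loop coefficients
`β_k` with `C₋ ≤ β_k ≤ C₊`, `C₋ > 0` (the paper's Lemma 11) the *quadratic flow*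
`ḡ_{k+1} = ḡ_k + β_k ḡ_k²` is solved BACKWARDS from the final condition `ḡ_N = g_f > 0`
("`ḡ_{k+1} > 0` determines `ḡ_k > 0` as the unique positive root of `β_k ḡ_k² + ḡ_k − ḡ_{k+1} = 0`
which is `ḡ_k = (2β_k)⁻¹(−1 + √(1 + 4β_k ḡ_{k+1}))`. So starting with `ḡ_N = g_f` we get `ḡ_{N−1}`,
then `ḡ_{N−2}`, etc. and `ḡ_N > ḡ_{N−1} > ⋯ > ḡ_0 > 0`"), the identity
"`ḡ_k⁻¹ − ḡ_{k+1}⁻¹ = β_k/(1 + β_k ḡ_k)`", the step bounds "`½C₋ ≤ ḡ_k⁻¹ − ḡ_{k+1}⁻¹ ≤ C₊`" under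
"`C₊ ḡ_k ≤ C₊ g_f ≤ 1`", their telescoped form
"`g_f⁻¹ + ½C₋(N−k) ≤ ḡ_k⁻¹ ≤ g_f⁻¹ + C₊(N−k)`", the two-sided bound (candy)
"`g_f/(1 + C₊ g_f (N−k)) ≤ ḡ_k ≤ g_f/(1 + ½C₋ g_f (N−k))`", the telescoping identity
`Σ_{ℓ=j}^{n−1} β_ℓ ḡ_ℓ² = ḡ_n − ḡ_j` (the `n = 2, m = 0` instance of (basicbound), which the paper
states without proof "similar to those of Lemma 2.1 in [BBS15c]"), part (2) of the lemma:
for `|θ_ℓ| ≤ C` the field-strength flow `z̄_k = Σ_{ℓ<k} θ_ℓ ḡ_ℓ²` obeys `|z̄_k| ≤ (C/C₋) ḡ_k`; and (v2) the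
first line of (basicbound), "`Σ_{ℓ=j}^k β_ℓ ḡ_ℓ ≤ 𝒪(1)|log ḡ_j|`" — printed WITHOUT proof — with the explicit
constant `2` (per step `t/2 ≤ 1 − (1+t)⁻¹ ≤ log(1+t)`, `t = β_ℓ ḡ_ℓ ≤ 1`).

**Why it is in the tree.**  It is the printed and proved analog — for the marginal, asymptotically
free coupling of the `d = 2` Gross–Neveu model — of the two-sided trajectory bound (0.31) of Bałaban's
CMP 109 (1987) Theorem 2 for lattice Yang–Mills in `d = 4` (whose proof is not in print; cell files
MISSING.md §A1, TEMPLATE.md §16.2).  The Bałaban-shaped statement (recursion `1/g_k² = 1/g_{k+1}² +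
β_{k+1}(g_k)`, LINEAR in `1/g²`) is kernel-checked separately in
`Literature.MathematicalPhysics.QuantumFieldTheory.Balaban1983to89.Step` (`inv_sq_telescope`,
`discrete031_of_trajBounds`); the present recursion is in `g` itself and its telescoping in `1/ḡ`
carries the extra factor `(1 + β_k ḡ_k)⁻¹ ∈ [½, 1]`.  SCOPE: Dimock–Yuan's renormalization group is a
momentum-slice Gaussian decomposition on the continuum torus, not Bałaban's block averaging; only
this elementary flow lemma is model-independent.  Nothing in this file refers to or asserts
anything about Bałaban's papers.

(v3, cell unit `b2b-balaban-template` gen 24 — CITATION HYGIENE ONLY, declarations byte-identical: the bib key is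
corrected from the superseded `DimockYuan2024GrossNeveuFlow` (wrong doi/pages, marked «do not use» in references.bib) to
`DimockYuan2024GNFlow` (doi 10.1007/s00023-024-01427-0) in the header and in every `[cite:]` tag — XREAD C-pv02g20-4 INFO I4.)
-/

noncomputable section

open Finset Real

namespace Literature.MathematicalPhysics.QuantumFieldTheory.DimockYuan2024

/-! ## The backward step: the positive root of `β x² + x = g'` -/

/-- The backward step of the quadratic flow: for `β > 0`, `g' > 0`, the unique positive root `x` of
`β x² + x − g' = 0`, "`ḡ_k = (2β_k)⁻¹(−1 + √(1 + 4β_k ḡ_{k+1}))`".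
[cite: DimockYuan2024GNFlow, proof of Lemma 17 (arXiv TeX ll. 3340–3346)] -/
def qflowPrev (β g' : ℝ) : ℝ := (-1 + Real.sqrt (1 + 4 * β * g')) / (2 * β)

/-- `1 ≤ √(1 + 4βg')` for `β, g' ≥ 0` (elementary). [folklore] -/
theorem one_le_sqrt_disc {β g' : ℝ} (hβ : 0 ≤ β) (hg : 0 ≤ g') :
    1 ≤ Real.sqrt (1 + 4 * β * g') := by
  rw [show (1 : ℝ) = Real.sqrt 1 from Real.sqrt_one.symm]
  conv_rhs => rw [Real.sqrt_one]
  exact Real.sqrt_le_sqrt (by nlinarith [mul_nonneg hβ hg])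

/-- The backward step is nonnegative for `g' ≥ 0`. [cite: DimockYuan2024GNFlow, proof of Lemma 17 (arXiv TeX ll. 3340–3346)] -/
theorem qflowPrev_nonneg {β g' : ℝ} (hβ : 0 < β) (hg : 0 ≤ g') : 0 ≤ qflowPrev β g' := by
  unfold qflowPrev
  have h1 := one_le_sqrt_disc hβ.le hg
  exact div_nonneg (by linarith) (by linarith)

/-- The backward step is positive for `g' > 0` ("determines `ḡ_k > 0`"). [cite: DimockYuan2024GNFlow, proof of Lemma 17 (arXiv TeX ll. 3340–3346)] -/
theorem qflowPrev_pos {β g' : ℝ} (hβ : 0 < β) (hg : 0 < g') : 0 < qflowPrev β g' := by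
  unfold qflowPrev
  have h1 : (1 : ℝ) < Real.sqrt (1 + 4 * β * g') := by
    have h0 : (0 : ℝ) ≤ 1 := by norm_num
    rw [Real.lt_sqrt h0]
    nlinarith [mul_pos hβ hg]
  exact div_pos (by linarith) (by linarith)

/-- The defining equation: `β x² + x = g'` for `x = qflowPrev β g'`. [cite: DimockYuan2024GNFlow, proof of Lemma 17 ("root of β_k ḡ_k² + ḡ_k − ḡ_{k+1} = 0", arXiv TeX ll. 3340–3344)] -/
theorem qflowPrev_spec {β g' : ℝ} (hβ : 0 < β) (hg : 0 ≤ g') :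
    β * (qflowPrev β g') ^ 2 + qflowPrev β g' = g' := by
  unfold qflowPrev
  set s := Real.sqrt (1 + 4 * β * g') with hs
  have hs2 : s ^ 2 = 1 + 4 * β * g' := by
    rw [hs]; exact Real.sq_sqrt (by nlinarith [mul_nonneg hβ.le hg])
  have hβ0 : β ≠ 0 := hβ.ne'
  have : β * ((-1 + s) / (2 * β)) ^ 2 + (-1 + s) / (2 * β) = (s ^ 2 - 1) / (4 * β) := by
    field_simp
    ring
  rw [this, hs2]
  field_simp
  ring

/-- Uniqueness of the nonnegative root ("the unique positive root"). [cite: DimockYuan2024GNFlow, proof of Lemma 17 (arXiv TeX l. 3341)] -/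
theorem qflowPrev_unique {β g' x : ℝ} (hβ : 0 < β) (hg : 0 ≤ g') (hx : 0 ≤ x)
    (h : β * x ^ 2 + x = g') : x = qflowPrev β g' := by
  have h2 := qflowPrev_spec hβ hg
  have hy := qflowPrev_nonneg hβ hg
  have hprod : (x - qflowPrev β g') * (β * (x + qflowPrev β g') + 1) = 0 := by
    linear_combination h - h2
  rcases mul_eq_zero.mp hprod with h0 | h0
  · linarith
  · nlinarith [mul_nonneg hβ.le (add_nonneg hx hy)]

/-- `x ≤ βx² + x = g'`: one backward step does not increase the coupling. [cite: DimockYuan2024GNFlow, proof of Lemma 17 ("ḡ_N > ḡ_{N-1} > ⋯", arXiv TeX l. 3346)] -/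
theorem qflowPrev_le {β g' : ℝ} (hβ : 0 < β) (hg : 0 ≤ g') : qflowPrev β g' ≤ g' := by
  have h2 := qflowPrev_spec hβ hg
  nlinarith [sq_nonneg (qflowPrev β g'), hβ]

/-! ## The backward solution `ḡ_k`, `0 ≤ k ≤ N`, from the final condition `ḡ_N = g_f` -/

/-- Auxiliary: `gbarRev β N g_f m = ḡ_{N−m}`, defined by recursion on the number `m` of backward
steps ("starting with `ḡ_N = g_f` we get `ḡ_{N−1}`, then `ḡ_{N−2}`, etc."). [cite: DimockYuan2024GNFlow, proof of Lemma 17 (arXiv TeX ll. 3344–3346)] -/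
def gbarRev (β : ℕ → ℝ) (N : ℕ) (gf : ℝ) : ℕ → ℝ
  | 0 => gf
  | m + 1 => qflowPrev (β (N - (m + 1))) (gbarRev β N gf m)

/-- The quadratic flow `ḡ_k` (`0 ≤ k ≤ N`) with final condition `ḡ_N = g_f`:
"Define `ḡ_k` for `0 ≤ k ≤ N` by `ḡ_{k+1} = ḡ_k + β_k ḡ_k²` and `ḡ_N = g_f > 0`."
(For `k > N` the definition returns `g_f`; only `k ≤ N` is meaningful.)
[cite: DimockYuan2024GNFlow, Lemma 17 (1) (arXiv TeX ll. 3325–3331)] -/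
def gbar (β : ℕ → ℝ) (N : ℕ) (gf : ℝ) (k : ℕ) : ℝ := gbarRev β N gf (N - k)

variable {β : ℕ → ℝ} {N : ℕ} {gf : ℝ}

/-- The final condition `ḡ_N = g_f`. [cite: DimockYuan2024GNFlow, Lemma 17 (1)] -/
@[simp] theorem gbar_final (β : ℕ → ℝ) (N : ℕ) (gf : ℝ) : gbar β N gf N = gf := by
  simp [gbar, gbarRev]

/-- Backward recursion: `ḡ_k` is the positive root determined by `ḡ_{k+1}` (`k < N`). [cite: DimockYuan2024GNFlow, proof of Lemma 17 (arXiv TeX ll. 3340–3346)] -/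
theorem gbar_eq_qflowPrev {k : ℕ} (hk : k < N) :
    gbar β N gf k = qflowPrev (β k) (gbar β N gf (k + 1)) := by
  have hm : N - k = (N - (k + 1)) + 1 := by omega
  simp only [gbar, hm, gbarRev]
  congr 2
  omega

/-- Positivity along the backward recursion. [cite: DimockYuan2024GNFlow, proof of Lemma 17 (arXiv TeX l. 3346)] -/
theorem gbarRev_pos (hβ : ∀ k, 0 < β k) (hgf : 0 < gf) : ∀ m, 0 < gbarRev β N gf m
  | 0 => by simpa [gbarRev] using hgf
  | m + 1 => by
    simp only [gbarRev]
    exact qflowPrev_pos (hβ _) (gbarRev_pos hβ hgf m)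

/-- "`ḡ_0 > 0`" (indeed every `ḡ_k > 0`). [cite: DimockYuan2024GNFlow, Lemma 17 / proof (arXiv TeX l. 3346)] -/
theorem gbar_pos (hβ : ∀ k, 0 < β k) (hgf : 0 < gf) (k : ℕ) : 0 < gbar β N gf k :=
  gbarRev_pos hβ hgf _

/-- Boundedness by the final value along the backward recursion. [cite: DimockYuan2024GNFlow, proof of Lemma 17 (arXiv TeX l. 3362)] -/
theorem gbarRev_le (hβ : ∀ k, 0 < β k) (hgf : 0 < gf) : ∀ m, gbarRev β N gf m ≤ gf
  | 0 => by simp [gbarRev]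
  | m + 1 => by
    simp only [gbarRev]
    exact (qflowPrev_le (hβ _) (gbarRev_pos hβ hgf m).le).trans (gbarRev_le hβ hgf m)

/-- `ḡ_k ≤ g_f` ("We can assume `C₊ ḡ_k ≤ C₊ g_f`"). [cite: DimockYuan2024GNFlow, proof of Lemma 17 (arXiv TeX l. 3362)] -/
theorem gbar_le_final (hβ : ∀ k, 0 < β k) (hgf : 0 < gf) (k : ℕ) : gbar β N gf k ≤ gf :=
  gbarRev_le hβ hgf _

/-- The recursion of the quadratic flow, forwards: `ḡ_{k+1} = ḡ_k + β_k ḡ_k²` for `k < N`.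
[cite: DimockYuan2024GNFlow, Lemma 17 (1)] -/
theorem gbar_succ (hβ : ∀ k, 0 < β k) (hgf : 0 < gf) {k : ℕ} (hk : k < N) :
    gbar β N gf (k + 1) = gbar β N gf k + β k * gbar β N gf k ^ 2 := by
  have h := qflowPrev_spec (hβ k) (gbar_pos hβ hgf (N := N) (k + 1)).le
  rw [← gbar_eq_qflowPrev hk] at h
  linarith

/-- Strict monotonicity: "`ḡ_N > ḡ_{N−1} > ⋯ > ḡ_0 > 0`". [cite: DimockYuan2024GNFlow, proof of Lemma 17 (arXiv TeX l. 3346)] -/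
theorem gbar_lt_succ (hβ : ∀ k, 0 < β k) (hgf : 0 < gf) {k : ℕ} (hk : k < N) :
    gbar β N gf k < gbar β N gf (k + 1) := by
  rw [gbar_succ hβ hgf hk]
  have := mul_pos (hβ k) (pow_pos (gbar_pos hβ hgf (N := N) k) 2)
  linarith

/-- "`ḡ_k⁻¹ − ḡ_{k+1}⁻¹ = β_k ḡ_k² / (ḡ_k(ḡ_k + β_k ḡ_k²)) = β_k/(1 + β_k ḡ_k)`".
[cite: DimockYuan2024GNFlow, proof of Lemma 17 (arXiv TeX ll. 3349–3357)] -/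
theorem inv_gbar_sub_inv_gbar_succ (hβ : ∀ k, 0 < β k) (hgf : 0 < gf) {k : ℕ} (hk : k < N) :
    1 / gbar β N gf k - 1 / gbar β N gf (k + 1) = β k / (1 + β k * gbar β N gf k) := by
  rw [gbar_succ hβ hgf hk]
  have hx := gbar_pos hβ hgf (N := N) k
  have hx0 : gbar β N gf k ≠ 0 := hx.ne'
  have h1 : 1 + β k * gbar β N gf k ≠ 0 := by
    have := mul_pos (hβ k) hx; linarith
  have h2 : gbar β N gf k + β k * gbar β N gf k ^ 2 ≠ 0 := by
    have := mul_pos (hβ k) (pow_pos hx 2); linarith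
  rw [div_sub_div _ _ hx0 h2, div_eq_div_iff (mul_ne_zero hx0 h2) h1]
  ring

/-- The step bounds "`½C₋ ≤ ḡ_k⁻¹ − ḡ_{k+1}⁻¹ ≤ C₊`" under `C₋ ≤ β_k ≤ C₊` and the smallness
"`C₊ ḡ_k ≤ C₊ g_f ≤ 1`". [cite: DimockYuan2024GNFlow, proof of Lemma 17 (arXiv TeX ll. 3358–3366)] -/
theorem inv_gbar_step_bounds {Cm Cp : ℝ} (hCm : 0 < Cm) (hβ : ∀ k, Cm ≤ β k ∧ β k ≤ Cp)
    (hgf : 0 < gf) (hsmall : Cp * gf ≤ 1) {k : ℕ} (hk : k < N) :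
    Cm / 2 ≤ 1 / gbar β N gf k - 1 / gbar β N gf (k + 1) ∧
      1 / gbar β N gf k - 1 / gbar β N gf (k + 1) ≤ Cp := by
  have hβpos : ∀ k, 0 < β k := fun k => lt_of_lt_of_le hCm (hβ k).1
  rw [inv_gbar_sub_inv_gbar_succ hβpos hgf hk]
  have hx := gbar_pos hβpos hgf (N := N) k
  have hxle := gbar_le_final hβpos hgf (N := N) k
  have hβk := hβ k
  have hbx : β k * gbar β N gf k ≤ 1 := by
    calc β k * gbar β N gf k ≤ Cp * gf :=
          mul_le_mul hβk.2 hxle hx.le (le_trans hCm.le (hβk.1.trans hβk.2))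
      _ ≤ 1 := hsmall
  have hden : 0 < 1 + β k * gbar β N gf k := by
    have := mul_pos (hβpos k) hx; linarith
  constructor
  · rw [le_div_iff₀ hden]
    nlinarith [hβk.1]
  · rw [div_le_iff₀ hden]
    nlinarith [hβk.2, mul_pos (hβpos k) hx, le_trans hCm.le (hβk.1.trans hβk.2)]

/-- Telescoped: "`g_f⁻¹ + ½C₋(N−k) ≤ ḡ_k⁻¹ ≤ g_f⁻¹ + C₊(N−k)`" for `k ≤ N` (`N − k` the natural-number
difference). [cite: DimockYuan2024GNFlow, proof of Lemma 17 (arXiv TeX ll. 3367–3376)] -/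
theorem inv_gbar_bounds {Cm Cp : ℝ} (hCm : 0 < Cm) (hβ : ∀ k, Cm ≤ β k ∧ β k ≤ Cp)
    (hgf : 0 < gf) (hsmall : Cp * gf ≤ 1) {k : ℕ} (hk : k ≤ N) :
    1 / gf + Cm / 2 * ((N - k : ℕ) : ℝ) ≤ 1 / gbar β N gf k ∧
      1 / gbar β N gf k ≤ 1 / gf + Cp * ((N - k : ℕ) : ℝ) := by
  -- induction on the number of backward steps `m = N - k`
  suffices H : ∀ m, m ≤ N →
      1 / gf + Cm / 2 * (m : ℝ) ≤ 1 / gbar β N gf (N - m) ∧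
        1 / gbar β N gf (N - m) ≤ 1 / gf + Cp * (m : ℝ) by
    have := H (N - k) (Nat.sub_le N k)
    rwa [show N - (N - k) = k by omega] at this
  intro m
  induction m with
  | zero => intro _; simp
  | succ m ih =>
    intro hm
    have hm' : m ≤ N := Nat.le_of_succ_le hm
    obtain ⟨ih1, ih2⟩ := ih hm'
    have hk' : N - (m + 1) < N := by omega
    have hstep := inv_gbar_step_bounds (β := β) (N := N) hCm hβ hgf hsmall hk'
    have hkk : N - (m + 1) + 1 = N - m := by omega
    rw [hkk] at hstep
    push_cast
    constructor <;> linarith [hstep.1, hstep.2]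

/-- **Lemma 17 (1), eq. (candy)**: "For `g_f` sufficiently small it is bounded by
`g_f/(1 + C₊ g_f (N−k)) ≤ ḡ_k ≤ g_f/(1 + ½C₋ g_f (N−k))`" — here with the explicit smallness
condition `C₊ g_f ≤ 1` used in the printed proof.
[cite: DimockYuan2024GNFlow, Lemma 17 (1) (arXiv TeX ll. 3325–3331, (candy))] -/
theorem gbar_bounds {Cm Cp : ℝ} (hCm : 0 < Cm) (hβ : ∀ k, Cm ≤ β k ∧ β k ≤ Cp)
    (hgf : 0 < gf) (hsmall : Cp * gf ≤ 1) {k : ℕ} (hk : k ≤ N) :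
    gf / (1 + Cp * gf * ((N - k : ℕ) : ℝ)) ≤ gbar β N gf k ∧
      gbar β N gf k ≤ gf / (1 + Cm / 2 * gf * ((N - k : ℕ) : ℝ)) := by
  have hβpos : ∀ k, 0 < β k := fun k => lt_of_lt_of_le hCm (hβ k).1
  obtain ⟨h1, h2⟩ := inv_gbar_bounds (β := β) hCm hβ hgf hsmall hk
  have hx := gbar_pos hβpos hgf (N := N) k
  have hCp : 0 ≤ Cp := le_trans hCm.le ((hβ 0).1.trans (hβ 0).2)
  set m : ℝ := ((N - k : ℕ) : ℝ) with hm
  have hm0 : 0 ≤ m := by rw [hm]; exact Nat.cast_nonneg _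
  have hA : 0 < 1 + Cp * gf * m := by
    have := mul_nonneg (mul_nonneg hCp hgf.le) hm0; linarith
  have hB : 0 < 1 + Cm / 2 * gf * m := by
    have := mul_nonneg (mul_nonneg (by linarith : 0 ≤ Cm / 2) hgf.le) hm0; linarith
  constructor
  · -- from 1/ḡ ≤ (1 + C₊ g_f m)/g_f
    have h2' : 1 / gbar β N gf k ≤ (1 + Cp * gf * m) / gf := by
      have : (1 + Cp * gf * m) / gf = 1 / gf + Cp * m := by
        field_simp
      rw [this]; exact h2
    have := one_div_le_one_div_of_le (one_div_pos.mpr hx) h2'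
    rw [one_div_one_div, one_div_div] at this
    exact this
  · have h1' : (1 + Cm / 2 * gf * m) / gf ≤ 1 / gbar β N gf k := by
      have : (1 + Cm / 2 * gf * m) / gf = 1 / gf + Cm / 2 * m := by
        field_simp
      rw [this]; exact h1
    have := one_div_le_one_div_of_le (div_pos hB hgf) h1'
    rw [one_div_one_div, one_div_div] at this
    exact this

/-! ## The `n = 2, m = 0` case of (basicbound) and part (2) of Lemma 17 -/

/-- Telescoping: `Σ_{ℓ ∈ [j,n)} β_ℓ ḡ_ℓ² = ḡ_n − ḡ_j` for `j ≤ n ≤ N` ("One can deduce directly from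
the equation `ḡ_{k+1} = ḡ_k + β_k ḡ_k²` that … `Σ_{ℓ=j}^k β_ℓ ḡ_ℓ^n |log ḡ_ℓ|^m ≤ 𝒪(1) ḡ_{k+1}^{n−1}
|log ḡ_{k+1}|^m`", case `n = 2, m = 0`, where it is an identity).
[cite: DimockYuan2024GNFlow, remark after Lemma 17, (basicbound) (arXiv TeX ll. 3386–3395)] -/
theorem sum_beta_gbar_sq (hβ : ∀ k, 0 < β k) (hgf : 0 < gf) {j n : ℕ} (hjn : j ≤ n) (hn : n ≤ N) :
    ∑ ℓ ∈ Ico j n, β ℓ * gbar β N gf ℓ ^ 2 = gbar β N gf n - gbar β N gf j := by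
  induction n, hjn using Nat.le_induction with
  | base => simp
  | succ n hjn ih =>
    rw [Finset.sum_Ico_succ_top hjn, ih (Nat.le_of_succ_le hn),
      gbar_succ hβ hgf (Nat.lt_of_succ_le hn)]
    ring

/-- The quadratic field-strength flow "`z̄_{k+1} = z̄_k + θ_k ḡ_k²` and `z_0 = 0`", i.e.
`z̄_k = Σ_{ℓ=0}^{k−1} θ_ℓ ḡ_ℓ²`. [cite: DimockYuan2024GNFlow, Lemma 17 (2) (arXiv TeX ll. 3332–3334, 3379–3383)] -/
def zbar (θ β : ℕ → ℝ) (N : ℕ) (gf : ℝ) (k : ℕ) : ℝ :=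
  ∑ ℓ ∈ range k, θ ℓ * gbar β N gf ℓ ^ 2

/-- Initial condition `z̄_0 = 0`. [cite: DimockYuan2024GNFlow, Lemma 17 (2)] -/
@[simp] theorem zbar_zero (θ β : ℕ → ℝ) (N : ℕ) (gf : ℝ) : zbar θ β N gf 0 = 0 := by
  simp [zbar]

/-- The recursion "`z̄_{k+1} = z̄_k + θ_k ḡ_k²`". [cite: DimockYuan2024GNFlow, Lemma 17 (2) (arXiv TeX ll. 3332–3334)] -/
theorem zbar_succ (θ β : ℕ → ℝ) (N : ℕ) (gf : ℝ) (k : ℕ) :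
    zbar θ β N gf (k + 1) = zbar θ β N gf k + θ k * gbar β N gf k ^ 2 := by
  simp [zbar, Finset.sum_range_succ]

/-- **Lemma 17 (2)**: "Then `|z̄_k| ≤ C ḡ_k`" — with the explicit constant `C/C₋` (`|θ_ℓ| ≤ C`,
`C₋ ≤ β_ℓ`): `|z̄_k| ≤ Σ_{ℓ<k} |θ_ℓ| ḡ_ℓ² ≤ (C/C₋) Σ_{ℓ<k} β_ℓ ḡ_ℓ² = (C/C₋)(ḡ_k − ḡ_0) ≤ (C/C₋) ḡ_k`.
[cite: DimockYuan2024GNFlow, Lemma 17 (2) and its proof (arXiv TeX ll. 3332–3334, 3379–3383)] -/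
theorem abs_zbar_le {θ : ℕ → ℝ} {Cm Cθ : ℝ} (hCm : 0 < Cm) (hβ : ∀ k, Cm ≤ β k)
    (hθ : ∀ k, |θ k| ≤ Cθ) (hgf : 0 < gf) {k : ℕ} (hk : k ≤ N) :
    |zbar θ β N gf k| ≤ Cθ / Cm * gbar β N gf k := by
  have hβpos : ∀ k, 0 < β k := fun k => lt_of_lt_of_le hCm (hβ k)
  have hCθ : 0 ≤ Cθ := le_trans (abs_nonneg _) (hθ 0)
  unfold zbar
  calc |∑ ℓ ∈ range k, θ ℓ * gbar β N gf ℓ ^ 2|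
      ≤ ∑ ℓ ∈ range k, |θ ℓ * gbar β N gf ℓ ^ 2| := Finset.abs_sum_le_sum_abs _ _
    _ ≤ ∑ ℓ ∈ range k, Cθ / Cm * (β ℓ * gbar β N gf ℓ ^ 2) := by
        apply Finset.sum_le_sum
        intro ℓ _
        rw [abs_mul, abs_of_nonneg (sq_nonneg (gbar β N gf ℓ))]
        have hg2 : 0 ≤ gbar β N gf ℓ ^ 2 := sq_nonneg _
        have h1 : |θ ℓ| ≤ Cθ / Cm * β ℓ := by
          have : Cθ ≤ Cθ / Cm * β ℓ := by
            rw [div_mul_eq_mul_div, le_div_iff₀ hCm]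
            exact mul_le_mul_of_nonneg_left (hβ ℓ) hCθ
          exact (hθ ℓ).trans this
        calc |θ ℓ| * gbar β N gf ℓ ^ 2 ≤ (Cθ / Cm * β ℓ) * gbar β N gf ℓ ^ 2 :=
              mul_le_mul_of_nonneg_right h1 hg2
          _ = Cθ / Cm * (β ℓ * gbar β N gf ℓ ^ 2) := by ring
    _ = Cθ / Cm * (gbar β N gf k - gbar β N gf 0) := by
        rw [← Finset.mul_sum, Finset.range_eq_Ico, sum_beta_gbar_sq hβpos hgf (Nat.zero_le k) hk]
    _ ≤ Cθ / Cm * gbar β N gf k := by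
        have h0 := (gbar_pos hβpos hgf (N := N) 0).le
        have hc : 0 ≤ Cθ / Cm := div_nonneg hCθ hCm.le
        nlinarith

/-- **Dimock–Yuan 2024, Lemma 17** (the quadratic flow), assembled: for `C₋ ≤ β_k ≤ C₊` with
`C₋ > 0`, `|θ_k| ≤ C`, and a final value `g_f > 0` with `C₊ g_f ≤ 1`, the backward solution `ḡ` of
`ḡ_{k+1} = ḡ_k + β_k ḡ_k²`, `ḡ_N = g_f` is positive and strictly increasing, satisfies (candy)
`g_f/(1 + C₊ g_f(N−k)) ≤ ḡ_k ≤ g_f/(1 + ½C₋ g_f(N−k))`, and `z̄_k = Σ_{ℓ<k} θ_ℓ ḡ_ℓ²` satisfies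
`|z̄_k| ≤ (C/C₋) ḡ_k`.
[cite: DimockYuan2024GNFlow, Lemma 17 (arXiv:2303.07916v3 TeX ll. 3323–3335)] -/
theorem DimockYuan2024_lemma17 (β θ : ℕ → ℝ) (N : ℕ) {Cm Cp Cθ gf : ℝ} (hCm : 0 < Cm)
    (hβ : ∀ k, Cm ≤ β k ∧ β k ≤ Cp) (hθ : ∀ k, |θ k| ≤ Cθ) (hgf : 0 < gf)
    (hsmall : Cp * gf ≤ 1) :
    gbar β N gf N = gf ∧
    (∀ k, k < N → gbar β N gf (k + 1) = gbar β N gf k + β k * gbar β N gf k ^ 2) ∧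
    (∀ k, 0 < gbar β N gf k) ∧
    (∀ k, k < N → gbar β N gf k < gbar β N gf (k + 1)) ∧
    (∀ k, k ≤ N → gf / (1 + Cp * gf * ((N - k : ℕ) : ℝ)) ≤ gbar β N gf k ∧
      gbar β N gf k ≤ gf / (1 + Cm / 2 * gf * ((N - k : ℕ) : ℝ))) ∧
    (∀ k, k ≤ N → |zbar θ β N gf k| ≤ Cθ / Cm * gbar β N gf k) := by
  have hβpos : ∀ k, 0 < β k := fun k => lt_of_lt_of_le hCm (hβ k).1
  refine ⟨gbar_final β N gf, fun k hk => gbar_succ hβpos hgf hk, gbar_pos hβpos hgf,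
    fun k hk => gbar_lt_succ hβpos hgf hk,
    fun k hk => gbar_bounds hCm hβ hgf hsmall hk,
    fun k hk => abs_zbar_le hCm (fun k => (hβ k).1) hθ hgf hk⟩

/-! ## The `n = 1, m = 0` case of (basicbound): `Σ_{ℓ=j}^{k} β_ℓ ḡ_ℓ ≤ 𝒪(1)|log ḡ_j|`

The paper states (remark after Lemma 17, (basicbound), arXiv TeX ll. 3386–3396): "One can deduce directly from
the equation `ḡ_{k+1} = ḡ_k + β_k ḡ_k²` that for `0 ≤ j ≤ k ≤ N`, `Σ_{ℓ=j}^k β_ℓ ḡ_ℓ ≤ 𝒪(1)|log ḡ_j|`" —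
without proof ("similar to those of Lemma 2.1 in [BBS15c]").  Below: the deduction, with the explicit constant
`𝒪(1) = 2`, under the smallness already used for (candy) (`β_ℓ ḡ_ℓ ≤ C₊ g_f ≤ 1`) and `g_f ≤ 1`:
per step `β_ℓ ḡ_ℓ = t`, `ḡ_{ℓ+1} = ḡ_ℓ (1 + t)` and `t/2 ≤ 1 − (1+t)⁻¹ ≤ log(1+t)` for `0 ≤ t ≤ 1`, then telescope. -/

/-- Per-step logarithmic gain: if `β_k ḡ_k ≤ 1` then `β_k ḡ_k ≤ 2 (log ḡ_{k+1} − log ḡ_k)`.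
[cite: DimockYuan2024GNFlow, remark after Lemma 17, (basicbound) first line (arXiv TeX ll. 3386–3392; printed without proof)] -/
theorem beta_gbar_le_two_mul_log_sub (hβ : ∀ k, 0 < β k) (hgf : 0 < gf) {k : ℕ} (hk : k < N)
    (ht1 : β k * gbar β N gf k ≤ 1) :
    β k * gbar β N gf k ≤
      2 * (Real.log (gbar β N gf (k + 1)) - Real.log (gbar β N gf k)) := by
  have hx := gbar_pos hβ hgf (N := N) k
  set t := β k * gbar β N gf k with ht_def
  have ht0 : 0 < t := mul_pos (hβ k) hx
  have hsucc : gbar β N gf (k + 1) = gbar β N gf k * (1 + t) := by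
    rw [gbar_succ hβ hgf hk, ht_def]; ring
  have hlog : Real.log (gbar β N gf (k + 1)) - Real.log (gbar β N gf k) = Real.log (1 + t) := by
    rw [hsucc, Real.log_mul hx.ne' (by linarith)]; ring
  rw [hlog]
  have h1 : 1 - (1 + t)⁻¹ ≤ Real.log (1 + t) := Real.one_sub_inv_le_log_of_pos (by linarith)
  have hne : (1 + t) ≠ 0 := by linarith
  have hinv : (1 + t)⁻¹ * (1 + t) = 1 := inv_mul_cancel₀ hne
  have hu : 0 < (1 + t)⁻¹ := inv_pos.mpr (by linarith)
  have h2 : t / 2 ≤ 1 - (1 + t)⁻¹ := by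
    nlinarith [mul_nonneg ht0.le (sub_nonneg.mpr ht1), hinv, hu]
  linarith

/-- **(basicbound), first line, with the constant made explicit**: for `j ≤ n ≤ N`,
`Σ_{ℓ ∈ [j,n)} β_ℓ ḡ_ℓ ≤ 2 (log ḡ_n − log ḡ_j)`, under `C₋ ≤ β_ℓ ≤ C₊`, `C₊ g_f ≤ 1`.
[cite: DimockYuan2024GNFlow, remark after Lemma 17, (basicbound) (arXiv TeX ll. 3386–3392; printed without proof)] -/
theorem sum_beta_gbar_le_two_mul_log_sub {Cm Cp : ℝ} (hCm : 0 < Cm) (hβ : ∀ k, Cm ≤ β k ∧ β k ≤ Cp)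
    (hgf : 0 < gf) (hsmall : Cp * gf ≤ 1) {j n : ℕ} (hjn : j ≤ n) (hn : n ≤ N) :
    ∑ ℓ ∈ Ico j n, β ℓ * gbar β N gf ℓ ≤
      2 * (Real.log (gbar β N gf n) - Real.log (gbar β N gf j)) := by
  have hβpos : ∀ k, 0 < β k := fun k => lt_of_lt_of_le hCm (hβ k).1
  have hCp : 0 ≤ Cp := le_trans hCm.le ((hβ 0).1.trans (hβ 0).2)
  have ht1 : ∀ ℓ, β ℓ * gbar β N gf ℓ ≤ 1 := fun ℓ =>
    (mul_le_mul (hβ ℓ).2 (gbar_le_final hβpos hgf (N := N) ℓ) (gbar_pos hβpos hgf (N := N) ℓ).le hCp).trans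
      hsmall
  induction n, hjn using Nat.le_induction with
  | base => simp
  | succ n hjn ih =>
    rw [Finset.sum_Ico_succ_top hjn]
    have h1 := ih (Nat.le_of_succ_le hn)
    have h2 := beta_gbar_le_two_mul_log_sub hβpos hgf (Nat.lt_of_succ_le hn) (ht1 n)
    linarith

/-- **(basicbound), first line, as printed**: `Σ_{ℓ ∈ [j,n)} β_ℓ ḡ_ℓ ≤ 2 |log ḡ_j|` for `j ≤ n ≤ N`, when in
addition `g_f ≤ 1` (so that all `ḡ_ℓ ≤ 1` and `log ḡ_n ≤ 0`).
[cite: DimockYuan2024GNFlow, remark after Lemma 17, (basicbound): "Σ_{ℓ=j}^k β_ℓ ḡ_ℓ ≤ 𝒪(1)|log ḡ_j|" (arXiv TeX ll. 3386–3392; printed without proof)] -/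
theorem sum_beta_gbar_le_abs_log {Cm Cp : ℝ} (hCm : 0 < Cm) (hβ : ∀ k, Cm ≤ β k ∧ β k ≤ Cp)
    (hgf : 0 < gf) (hgf1 : gf ≤ 1) (hsmall : Cp * gf ≤ 1) {j n : ℕ} (hjn : j ≤ n) (hn : n ≤ N) :
    ∑ ℓ ∈ Ico j n, β ℓ * gbar β N gf ℓ ≤ 2 * |Real.log (gbar β N gf j)| := by
  have hβpos : ∀ k, 0 < β k := fun k => lt_of_lt_of_le hCm (hβ k).1
  have h := sum_beta_gbar_le_two_mul_log_sub (β := β) hCm hβ hgf hsmall hjn hn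
  have hn0 : Real.log (gbar β N gf n) ≤ 0 :=
    Real.log_nonpos (gbar_pos hβpos hgf (N := N) n).le ((gbar_le_final hβpos hgf (N := N) n).trans hgf1)
  have hj : -Real.log (gbar β N gf j) ≤ |Real.log (gbar β N gf j)| := neg_le_abs _
  linarith

end Literature.MathematicalPhysics.QuantumFieldTheory.DimockYuan2024

end
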